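import Summits.Parity.BatemanHorn.Theorems.SoloInformedPolynomialUpperBound
import Summits.Parity.BatemanHorn.Theorems.SoloInformedQuadraticWindow

/-!
# The unconditional sieve window for `T_g`, every Bateman–Horn polynomial of degree `d ≥ 2`

Solo unit `solo-Parity-informed` (ideation tier, informed mode), session 13; `PLAN.md` §21, CLAIMS C59.

Session 12 (`SoloInformedQuadraticWindow`) proved, for quadratic `g`, the Chebyshev bound
`ψ_g(x) ≤ (4 C(g) + δ) x` and the window `-(3C + δ) x ≤ T_g(x; y) ≤ (C + δ) x` for the large-divisor
sum `T_g` of the split `ψ_g(x) - C x + T_g = o(x)`, using the square sieve to dispose of the proper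
prime powers among the values. Here the degree restriction is removed WITHOUT any prime-power input:
`ψ_g(x) = ∑_{n ≤ x} Λ(|g(n)|)` is bounded through the ROUGH values of `g` — a value with `Λ ≠ 0` is
either coprime to `P(z) = ∏_{p<z} p` or a power `p^k` of a prime `p < z`, and the latter `n` number
`O(z log x)` by the fibre bound `#{n : |g(n)| = m} ≤ 2d`:

* `eventually_psi_le` — `ψ_g(x) ≤ (2d C(g) + δ) x` (`2d` times the Bateman–Horn value `C(g) x`),
  `eventually_theta_le` — the same for `θ_g`;
* `eventually_neg_le_polyLargeDivisorSum` — `-((2d - 1) C(g) + δ) x ≤ T_g(x; y)` for every admissible cut;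
* `eventually_largeDivisorSum_mem_window_rpowCut` — at the cut `y = ⌊x^{1-ε}⌋`:
  `-((2d-1) C + δ) x ≤ T_g ≤ (C + δ) x` eventually, for every `g` of degree `d ≥ 2` forming a
  Bateman–Horn system. Bateman–Horn for `g` is the statement `T_g = o(x)` (session 11,
  `batemanHornAsymptotic_iff_largeDivisorSum_isLittleO_rpowCut_of_properPrimePow`, under the prime-power
  hypothesis; unconditionally `T_g = o(x)` implies it, `batemanHornAsymptotic_of_…` directions there).

References: H. Halberstam, H.-E. Richert, *Sieve Methods* (Academic Press 1974) Thm 5.3; P. T. Bateman,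
R. A. Horn, Math. Comp. 16 (1962) 363–367 [BatemanHorn1962]; E. Bombieri, *The asymptotic sieve*,
Rend. Accad. Naz. XL (5) 1/2 (1975/76) 243–269.
-/

namespace Summit.Parity.BatemanHorn.Theorems

open Finset Filter ArithmeticFunction Asymptotics Polynomial
open scoped ArithmeticFunction.Moebius Topology
open Literature.NumberTheory.Sieve (polyRootCountMod IsBatemanHornSystem batemanHornConst polyPrimeCount
  primesProdBelow dvd_primesProdBelow_iff)

/-! ### `ψ_g` through the rough values -/

/-- **`ψ_g(x) ≤ (d log x + B)(#{n ≤ x : |g(n)| z-rough} + #{n ≤ x : |g(n)| = m^k, m ≤ ⌈z⌉, k ≤ K_x})`**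
with `K_x = ⌊(d log x + B)/log 2⌋`, for `g` with `|log |g(n)| - d log n| ≤ B`: a value with
`Λ(|g(n)|) ≠ 0` not coprime to `P(z)` is `p^k` with `p < z`, `2^k ≤ |g(n)| ≤ e^B x^d`. -/
theorem vonMangoldt_polyVal_sum_le_rough_add (g : ℤ[X]) {B : ℝ}
    (hB : ∀ n : ℕ, 1 ≤ n → |Real.log ((g.eval (n : ℤ)).natAbs : ℝ) - g.natDegree * Real.log n| ≤ B)
    {x : ℕ} (hx : 1 ≤ x) (z : ℝ) :
    ∑ n ∈ Icc 1 x, Λ (g.eval (n : ℤ)).natAbs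
      ≤ (g.natDegree * Real.log x + B) *
          (#((Icc 1 x).filter fun n : ℕ => ((g.eval (n : ℤ)).natAbs).Coprime (primesProdBelow z))
            + #((range (⌈z⌉₊ + 1)).biUnion fun m : ℕ =>
                (range (⌊(g.natDegree * Real.log x + B) / Real.log 2⌋₊ + 1)).biUnion fun k : ℕ =>
                  (Icc 1 x).filter fun n : ℕ => (g.eval (n : ℤ)).natAbs = m ^ k)) := by
  set d := g.natDegree with hd
  set W : ℝ := d * Real.log x + B with hW
  set K := ⌊W / Real.log 2⌋₊ with hK
  set R := (Icc 1 x).filter (fun n : ℕ => ((g.eval (n : ℤ)).natAbs).Coprime (primesProdBelow z)) with hR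
  set CU := (range (⌈z⌉₊ + 1)).biUnion (fun m : ℕ => (range (K + 1)).biUnion fun k : ℕ =>
    (Icc 1 x).filter fun n : ℕ => (g.eval (n : ℤ)).natAbs = m ^ k) with hCU
  have hlogx : 0 ≤ Real.log x := Real.log_nonneg (by exact_mod_cast hx)
  have hlog2 : 0 < Real.log 2 := Real.log_pos (by norm_num)
  have hB0 : 0 ≤ B := (abs_nonneg _).trans (hB 1 le_rfl)
  have hW0 : 0 ≤ W := by rw [hW]; positivity
  -- the weights: `Λ(|g(n)|) ≤ log |g(n)| ≤ d log x + B`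
  have hlogval : ∀ n ∈ Icc 1 x, Real.log ((g.eval (n : ℤ)).natAbs : ℝ) ≤ W := by
    intro n hn
    obtain ⟨hn1, hnx⟩ := mem_Icc.mp hn
    have h1 := (abs_le.mp (hB n hn1)).2
    have h2 : Real.log n ≤ Real.log x :=
      Real.log_le_log (by exact_mod_cast hn1) (by exact_mod_cast hnx)
    have hd0 : (0 : ℝ) ≤ d := Nat.cast_nonneg _
    rw [hW]
    nlinarith
  have hw : ∀ n ∈ (Icc 1 x).filter (fun n : ℕ => Λ (g.eval (n : ℤ)).natAbs ≠ 0),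
      Λ (g.eval (n : ℤ)).natAbs ≤ W := fun n hn =>
    (vonMangoldt_le_log (n := (g.eval (n : ℤ)).natAbs)).trans (hlogval n (mem_filter.mp hn).1)
  -- where the non-zero weights live
  have hsub : (Icc 1 x).filter (fun n : ℕ => Λ (g.eval (n : ℤ)).natAbs ≠ 0) ⊆ R ∪ CU := by
    intro n hn
    obtain ⟨hnI, hΛ⟩ := mem_filter.mp hn
    obtain ⟨hn1, hnx⟩ := mem_Icc.mp hnI
    rw [mem_union]
    by_cases hc : ((g.eval (n : ℤ)).natAbs).Coprime (primesProdBelow z)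
    · exact Or.inl (mem_filter.mpr ⟨hnI, hc⟩)
    right
    obtain ⟨p, k, hp, hk, hpk⟩ := (isPrimePow_nat_iff _).mp (vonMangoldt_ne_zero_iff.mp hΛ)
    -- `p < z`
    have hpz : p ∈ range (⌈z⌉₊ + 1) := by
      rw [← hpk, Nat.coprime_pow_left_iff hk, Nat.Prime.coprime_iff_not_dvd hp, not_not] at hc
      have hltz : (p : ℝ) < z := (dvd_primesProdBelow_iff hp z).mp hc
      rw [mem_range]
      have := Nat.lt_ceil.mpr hltz
      omega
    -- `k ≤ K`
    have hkK : k ∈ range (K + 1) := by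
      rw [mem_range, Nat.lt_add_one_iff, hK]
      refine Nat.le_floor ?_
      rw [le_div_iff₀ hlog2]
      have hg0 : (0 : ℝ) < ((g.eval (n : ℤ)).natAbs : ℕ) := by
        rw [← hpk]; exact_mod_cast pow_pos hp.pos k
      have h2k : (2 : ℝ) ^ k ≤ ((g.eval (n : ℤ)).natAbs : ℕ) := by
        rw [← hpk]
        exact_mod_cast pow_le_pow_left₀ (by norm_num) hp.two_le k
      have h3 := Real.log_le_log (by positivity) h2k
      rw [Real.log_pow] at h3
      exact h3.trans (hlogval n hnI)
    exact mem_biUnion.mpr ⟨p, hpz, mem_biUnion.mpr ⟨k, hkK, mem_filter.mpr ⟨hnI, hpk.symm⟩⟩⟩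
  have hcard : (#((Icc 1 x).filter fun n : ℕ => Λ (g.eval (n : ℤ)).natAbs ≠ 0) : ℝ) ≤ #R + #CU := by
    exact_mod_cast (card_le_card hsub).trans (card_union_le _ _)
  calc ∑ n ∈ Icc 1 x, Λ (g.eval (n : ℤ)).natAbs
      = ∑ n ∈ (Icc 1 x).filter (fun n : ℕ => Λ (g.eval (n : ℤ)).natAbs ≠ 0), Λ (g.eval (n : ℤ)).natAbs :=
        (sum_filter_ne_zero _).symm
    _ ≤ #((Icc 1 x).filter fun n : ℕ => Λ (g.eval (n : ℤ)).natAbs ≠ 0) • W := sum_le_card_nsmul _ _ _ hw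
    _ ≤ W * (#R + #CU) := by
        rw [nsmul_eq_mul, mul_comm]
        gcongr

/-- The prime-power junk is negligible: for `0 < c < 1`, `d ≥ 1`, `B ≥ 0`, `δ > 0`, eventually
`(d log x + B) · (⌈x^c⌉ + 1)(K_x + 1)(2d) ≤ δ x`. -/
theorem eventually_powJunk_le {c : ℝ} (hc0 : 0 < c) (hc1 : c < 1) (d : ℕ) {B : ℝ} (hB0 : 0 ≤ B)
    {δ : ℝ} (hδ : 0 < δ) :
    ∀ᶠ x : ℕ in atTop, ((d : ℝ) * Real.log x + B) *
      (((⌈(x : ℝ) ^ c⌉₊ + 1) * (⌊((d : ℝ) * Real.log x + B) / Real.log 2⌋₊ + 1) * (2 * d) : ℕ) : ℝ)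
        ≤ δ * x := by
  have hlog2 : 0 < Real.log 2 := Real.log_pos (by norm_num)
  have hlog2' : 1 / Real.log 2 ≤ 2 := by
    rw [div_le_iff₀ hlog2]; have := Real.log_two_gt_d9; linarith
  have hd0 : (0 : ℝ) ≤ d := Nat.cast_nonneg _
  set A : ℝ := 6 * d * (d + 1) * (2 * d + 3) with hA
  have hA0 : 0 ≤ A := by rw [hA]; positivity
  have hJ := eventually_mul_rpow_mul_log_sq_le hc1 hA0 hδ
  have hlog : Tendsto (fun x : ℕ => Real.log x) atTop atTop :=
    Real.tendsto_log_atTop.comp tendsto_natCast_atTop_atTop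
  have hz1 : ∀ᶠ x : ℕ in atTop, (1 : ℝ) ≤ (x : ℝ) ^ c :=
    ((tendsto_rpow_atTop hc0).comp tendsto_natCast_atTop_atTop).eventually_ge_atTop 1
  filter_upwards [hJ, hlog.eventually (eventually_ge_atTop (max B 1)), hz1] with x hJx hL hz
  set L := Real.log x with hL'
  have hBL : B ≤ L := le_trans (le_max_left _ _) hL
  have hL1 : 1 ≤ L := le_trans (le_max_right _ _) hL
  -- the three factors
  have hWle : (d : ℝ) * L + B ≤ (d + 1) * L := by nlinarith
  have hW0 : 0 ≤ (d : ℝ) * L + B := by positivity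
  have hceil : ((⌈(x : ℝ) ^ c⌉₊ : ℕ) : ℝ) + 1 ≤ 3 * (x : ℝ) ^ c := by
    have := (Nat.ceil_lt_add_one (show 0 ≤ (x : ℝ) ^ c by positivity)).le
    linarith
  have hK : ((⌊((d : ℝ) * L + B) / Real.log 2⌋₊ : ℕ) : ℝ) + 1 ≤ (2 * d + 3) * L := by
    have hfl := Nat.floor_le (show 0 ≤ ((d : ℝ) * L + B) / Real.log 2 by positivity)
    have h1 : ((d : ℝ) * L + B) / Real.log 2 ≤ (d + 1) * L * 2 := by
      rw [div_eq_mul_one_div]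
      exact mul_le_mul hWle hlog2' (by positivity) (by positivity)
    nlinarith
  calc ((d : ℝ) * L + B) *
        (((⌈(x : ℝ) ^ c⌉₊ + 1) * (⌊((d : ℝ) * L + B) / Real.log 2⌋₊ + 1) * (2 * d) : ℕ) : ℝ)
      = ((d : ℝ) * L + B) * (((((⌈(x : ℝ) ^ c⌉₊ : ℕ) : ℝ) + 1) *
          ((((⌊((d : ℝ) * L + B) / Real.log 2⌋₊ : ℕ) : ℝ) + 1)) * (2 * d))) := by
        push_cast; ring
    _ ≤ ((d + 1) * L) * ((3 * (x : ℝ) ^ c * ((2 * d + 3) * L)) * (2 * d)) := by gcongr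
    _ = A * ((x : ℝ) ^ c * L ^ 2) := by rw [hA]; ring
    _ ≤ δ * x := hJx

/-- **`ψ_g(x) = ∑_{n ≤ x} Λ(|g(n)|) ≤ (2d C(g) + δ) x` eventually**, for every `g ∈ ℤ[X]` of degree
`d ≥ 2` forming a Bateman–Horn system (`2d` times the conjectured `ψ_g(x) ~ C(g) x`): the rough-values
sieve bound with weights `≤ d log x + B`, plus the negligible prime powers `p^k`, `p < x^c`. -/
theorem eventually_psi_le {g : ℤ[X]} (hg : IsBatemanHornSystem ![g]) (hdeg : 2 ≤ g.natDegree)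
    {δ : ℝ} (hδ : 0 < δ) :
    ∀ᶠ x : ℕ in atTop, ∑ n ∈ Icc 1 x, Λ (g.eval (n : ℤ)).natAbs ≤
      (2 * g.natDegree * batemanHornConst ![g] + δ) * x := by
  obtain ⟨𝔠, h𝔠def⟩ : ∃ 𝔠 : ℝ, 𝔠 = batemanHornConst ![g] := ⟨_, rfl⟩
  have h𝔠 : 0 < 𝔠 := by rw [h𝔠def]; exact (IsBatemanHornSystem.hasBatemanHornConst_holds hg).2
  rw [← h𝔠def]
  set d := g.natDegree with hd
  have hdeg0 : 0 < g.natDegree := by omega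
  have hd0 : (0 : ℝ) < d := by rw [hd]; exact_mod_cast hdeg0
  obtain ⟨B, hB⟩ := exists_abs_log_natAbs_eval_sub_le hdeg0
  rw [← hd] at hB
  have hB0 : 0 ≤ B := (abs_nonneg _).trans (hB 1 le_rfl)
  -- the rough values at level `x^c`
  obtain ⟨c, hc0, hc1, hR⟩ :=
    exists_level_eventually_card_rough_le hg hdeg (show 0 < δ / (4 * d) by positivity)
  rw [← h𝔠def] at hR
  have hJ := eventually_powJunk_le hc0 hc1 d hB0 (show 0 < δ / 4 by positivity)
  -- `B (2𝔠 + δ/(4d)) x / log x ≤ (δ/4) x` eventually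
  have hlog : Tendsto (fun x : ℕ => Real.log x) atTop atTop :=
    Real.tendsto_log_atTop.comp tendsto_natCast_atTop_atTop
  have hBsmall : ∀ᶠ x : ℕ in atTop, B * (2 * 𝔠 + δ / (4 * d)) ≤ δ / 4 * Real.log x := by
    have h := (hlog.const_mul_atTop (show 0 < δ / 4 by positivity)).eventually_ge_atTop
      (B * (2 * 𝔠 + δ / (4 * d)))
    filter_upwards [h] with x hx
    exact hx
  filter_upwards [hR, hJ, hBsmall, eventually_ge_atTop 2] with x hRx hJx hBx hx2
  have hx : (2 : ℝ) ≤ x := by exact_mod_cast hx2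
  have hx0 : (0 : ℝ) < x := by linarith
  have hlog0 : 0 < Real.log x := Real.log_pos (by linarith)
  have hW0 : 0 ≤ (d : ℝ) * Real.log x + B := by positivity
  have hmain := vonMangoldt_polyVal_sum_le_rough_add g hB (show 1 ≤ x by omega) ((x : ℝ) ^ c)
  rw [← hd] at hmain
  -- the rough part: `(d log x + B) · #R ≤ (d log x + B)(2𝔠 + δ/(4d)) x / log x`
  have hRx' : ((d : ℝ) * Real.log x + B) *
      (#((Icc 1 x).filter fun n : ℕ =>
        ((g.eval (n : ℤ)).natAbs).Coprime (primesProdBelow ((x : ℝ) ^ c))) : ℝ)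
        ≤ (2 * d * 𝔠 + δ / 4) * x + δ / 4 * x := by
    calc ((d : ℝ) * Real.log x + B) *
          (#((Icc 1 x).filter fun n : ℕ =>
            ((g.eval (n : ℤ)).natAbs).Coprime (primesProdBelow ((x : ℝ) ^ c))) : ℝ)
        ≤ ((d : ℝ) * Real.log x + B) * ((2 * 𝔠 + δ / (4 * d)) * x / Real.log x) :=
          mul_le_mul_of_nonneg_left hRx hW0
      _ = (2 * d * 𝔠 + δ / 4) * x + B * (2 * 𝔠 + δ / (4 * d)) * (x / Real.log x) := by
          field_simp
      _ ≤ (2 * d * 𝔠 + δ / 4) * x + δ / 4 * Real.log x * (x / Real.log x) := by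
          gcongr
      _ = (2 * d * 𝔠 + δ / 4) * x + δ / 4 * x := by
          field_simp
  calc ∑ n ∈ Icc 1 x, Λ (g.eval (n : ℤ)).natAbs
      ≤ ((d : ℝ) * Real.log x + B) *
          (#((Icc 1 x).filter fun n : ℕ =>
              ((g.eval (n : ℤ)).natAbs).Coprime (primesProdBelow ((x : ℝ) ^ c)))
            + #((range (⌈(x : ℝ) ^ c⌉₊ + 1)).biUnion fun m : ℕ =>
                (range (⌊((d : ℝ) * Real.log x + B) / Real.log 2⌋₊ + 1)).biUnion fun k : ℕ =>
                  (Icc 1 x).filter fun n : ℕ => (g.eval (n : ℤ)).natAbs = m ^ k)) := hmain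
    _ ≤ ((d : ℝ) * Real.log x + B) *
          (#((Icc 1 x).filter fun n : ℕ =>
              ((g.eval (n : ℤ)).natAbs).Coprime (primesProdBelow ((x : ℝ) ^ c)))
            + (((⌈(x : ℝ) ^ c⌉₊ + 1) * (⌊((d : ℝ) * Real.log x + B) / Real.log 2⌋₊ + 1) * (2 * d) : ℕ)
                : ℝ)) := by
        gcongr
        exact_mod_cast card_biUnion_natAbs_eval_eq_pow_le g hdeg0 (Icc 1 x) _ _
    _ = ((d : ℝ) * Real.log x + B) *
          (#((Icc 1 x).filter fun n : ℕ =>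
            ((g.eval (n : ℤ)).natAbs).Coprime (primesProdBelow ((x : ℝ) ^ c))) : ℝ)
          + ((d : ℝ) * Real.log x + B) *
            (((⌈(x : ℝ) ^ c⌉₊ + 1) * (⌊((d : ℝ) * Real.log x + B) / Real.log 2⌋₊ + 1) * (2 * d) : ℕ)
              : ℝ) := by ring
    _ ≤ (2 * d * 𝔠 + δ / 4) * x + δ / 4 * x + δ / 4 * x := add_le_add hRx' hJx
    _ ≤ (2 * d * 𝔠 + δ) * x := by
        have : 0 ≤ δ * x := by positivity
        linarith

/-- **`θ_g(x) ≤ (2d C(g) + δ) x` eventually** (`θ_g ≤ ψ_g`). -/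
theorem eventually_theta_le {g : ℤ[X]} (hg : IsBatemanHornSystem ![g]) (hdeg : 2 ≤ g.natDegree)
    {δ : ℝ} (hδ : 0 < δ) :
    ∀ᶠ x : ℕ in atTop,
      ∑ n ∈ (Icc 1 x).filter (fun n : ℕ => Nat.Prime (g.eval (n : ℤ)).natAbs),
          Real.log (((g.eval (n : ℤ)).natAbs : ℕ) : ℝ) ≤
        (2 * g.natDegree * batemanHornConst ![g] + δ) * x := by
  filter_upwards [eventually_psi_le hg hdeg hδ] with x hx
  exact (theta_le_psi g x).trans hx

/-! ### The lower wall and the window -/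

/-- **`-((2d - 1) C(g) + δ) x ≤ T_g(x; y)` eventually**, for every Bateman–Horn polynomial of degree
`d ≥ 2` and every admissible cut: `T_g = (C x - ψ_g) + o(x)` and `ψ_g ≤ (2dC + o(1)) x`. -/
theorem eventually_neg_le_polyLargeDivisorSum {g : ℤ[X]} (hg : IsBatemanHornSystem ![g])
    (hdeg : 2 ≤ g.natDegree) {y : ℕ → ℕ} (hy : Tendsto y atTop atTop)
    (hy' : (fun x : ℕ => Real.log (y x) * (y x : ℝ)) =o[atTop] fun x : ℕ => (x : ℝ)) {δ : ℝ} (hδ : 0 < δ) :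
    ∀ᶠ x : ℕ in atTop,
      -((2 * g.natDegree - 1) * batemanHornConst ![g] + δ) * x ≤
        ∑ n ∈ Icc 1 x,
          ∑ e ∈ ((g.eval (n : ℤ)).natAbs).divisors with y x < (g.eval (n : ℤ)).natAbs / e,
            (μ ((g.eval (n : ℤ)).natAbs / e) : ℝ) * Real.log ((((g.eval (n : ℤ)).natAbs / e : ℕ)) : ℝ) := by
  have hirr : Irreducible g := by simpa using hg.irreducible 0
  have hg0 : ∀ n : ℕ, g.eval (n : ℤ) ≠ 0 := eval_natCast_ne_zero_of_irreducible hirr hdeg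
  have hE := (polyMainError_isLittleO_of_cut hg hy hy').bound (half_pos hδ)
  filter_upwards [hE, eventually_psi_le hg hdeg (half_pos hδ)] with x hx hψ
  have hid := sum_vonMangoldt_polyVal_sub_add_largeDivisorSum_eq g hg0 x (y x) (batemanHornConst ![g])
  rw [Real.norm_eq_abs, Real.norm_natCast] at hx
  have h1 := (abs_le.mp hx).1
  have e : -((2 * (g.natDegree : ℝ) - 1) * batemanHornConst ![g] + δ) * x
      = batemanHornConst ![g] * x - (2 * g.natDegree * batemanHornConst ![g] + δ / 2) * x - δ / 2 * x := by
    ring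
  rw [e]
  linarith

/-- **The unconditional window at the cut `⌊x^{1-ε}⌋`** (`0 < ε < 1`), every degree `d ≥ 2`: for every
`δ > 0`, eventually `-((2d - 1) C(g) + δ) x ≤ T_g(x; ⌊x^{1-ε}⌋) ≤ (C(g) + δ) x`. Bateman–Horn for `g`
is `T_g(x; ⌊x^{1-ε}⌋) = o(x)`. -/
theorem eventually_largeDivisorSum_mem_window_rpowCut {g : ℤ[X]}
    (hg : IsBatemanHornSystem ![g]) (hdeg : 2 ≤ g.natDegree) {ε : ℝ} (hε : 0 < ε) (hε1 : ε < 1)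
    {δ : ℝ} (hδ : 0 < δ) :
    ∀ᶠ x : ℕ in atTop,
      -((2 * g.natDegree - 1) * batemanHornConst ![g] + δ) * x ≤
          ∑ n ∈ Icc 1 x,
            ∑ e ∈ ((g.eval (n : ℤ)).natAbs).divisors with ⌊(x : ℝ) ^ (1 - ε)⌋₊ < (g.eval (n : ℤ)).natAbs / e,
              (μ ((g.eval (n : ℤ)).natAbs / e) : ℝ) * Real.log ((((g.eval (n : ℤ)).natAbs / e : ℕ)) : ℝ)
        ∧ ∑ n ∈ Icc 1 x,
            ∑ e ∈ ((g.eval (n : ℤ)).natAbs).divisors with ⌊(x : ℝ) ^ (1 - ε)⌋₊ < (g.eval (n : ℤ)).natAbs / e,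
              (μ ((g.eval (n : ℤ)).natAbs / e) : ℝ) * Real.log ((((g.eval (n : ℤ)).natAbs / e : ℕ)) : ℝ)
          ≤ (batemanHornConst ![g] + δ) * x := by
  have hy := tendsto_floor_rpow_atTop (by linarith : (0 : ℝ) < 1 - ε)
  have hy' := rpowCut_mul_log_isLittleO hε hε1
  filter_upwards [eventually_neg_le_polyLargeDivisorSum hg hdeg hy hy' hδ,
    eventually_largeDivisorSum_le_of_cut hg hdeg hy hy' hδ] with x h1 h2
  exact ⟨h1, h2⟩

/-- **`π_g` and `θ_g` windows restated against the prediction.** For `g` of degree `d ≥ 2` forming a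
Bateman–Horn system: `π_g(N) log N / N ≤ 2 C(g) + δ` and `θ_g(x)/x ≤ 2d C(g) + δ` eventually, while the
conjecture asserts the limits `C(g)/d · d = C(g)` for `θ_g(x)/x` and `C(g)/d` for `π_g(N) log N/N`. -/
theorem eventually_polyPrimeCount_mul_log_div_le {g : ℤ[X]} (hg : IsBatemanHornSystem ![g])
    (hdeg : 2 ≤ g.natDegree) {δ : ℝ} (hδ : 0 < δ) :
    ∀ᶠ N : ℕ in atTop,
      (polyPrimeCount ![g] N : ℝ) * Real.log N / N ≤ 2 * batemanHornConst ![g] + δ := by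
  filter_upwards [eventually_polyPrimeCount_le hg hdeg hδ, eventually_ge_atTop 2] with N hπ hN2
  have hN : (2 : ℝ) ≤ N := by exact_mod_cast hN2
  have hN0 : (0 : ℝ) < N := by linarith
  have hlog0 : 0 < Real.log N := Real.log_pos (by linarith)
  rw [le_div_iff₀ hlog0] at hπ
  rw [div_le_iff₀ hN0]
  exact hπ

end Summit.Parity.BatemanHorn.Theorems
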